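import Summits.QuantumFields.BalabanUV.T4Continuum.Support.B13AssemblyCoresEndSubstrateShiftMeasOp
import Summits.QuantumFields.BalabanUV.T4Continuum.Support.B13StepEndInsOpBalaban
import Summits.QuantumFields.BalabanUV.T4Continuum.Support.SubstrateO1ReadingsShift

/-!
# B13AssemblyCoresEndSubstrateShiftBalabanUniform — NE5 ∕ U3: ONE CONSTANT FOR EVERY DRIVEN TWO-RUN OBJECT AND EVERY LETTER PACKAGE (η-UNIFORMITY
# AT THE SUBSTRATE's **LEVEL-SHIFTED** O1 INSTANCE `slotsOfRecordShift`, W-21) ON THE (2.14)-CORES ROAD, W1 PRODUCED AT BAŁABAN's TIER-B BACKGROUND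
# (substrate-p1's L-E9b `SubstrateO1ReadingsShift`), ARITHMETIC LETTERS CHOSEN FROM THE SIZES — the η-uniform companion of
# `B13AssemblyCoresEndSubstrateShiftBalaban` (this lineage, same generation), built on this lineage's EXPLICIT-CONSTANT face
# `B13AssemblyCoresEndSubstrateShiftMeasOp.ne5_substrateShift_cores_actNorm` BY NAME; the twin of this lineage's p229762 re-pointed per NE5 owner R53 ∕ R54

Cell `pub-balaban`, unit `b2b-balaban-t4-ne5-formalise-leaf-08` (NE5 formalisation swarm, LEAF PROVER 08, gen 13; the (2.14)-CORES ROAD lineage;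
typer `t4/formal/NE5/LEAVES.md` CLAIM RULE 7 (b) ∕ CLAIM RULE 1; journal INTENT `HOME/CLAIMS.log` l.20070).  WHY THE RE-POINT: as in the companion
module — p229762 is stated at the UNSHIFTED `slotsOfRecord` and re-displays L-E9's pair `hcovA ∧ hcovB`, jointly inhabitable there only by towers
without a level step on the read entries (located point F-ne5p1-g37-1; docstring-level flag, nothing false); the substrate re-pointed run B's `.cov`
slot one level deeper (W-21, owner R54 (1) (α)) and re-stated the O1 face there (L-E9b); THIS module is p229762 with `slotsOfRecord ↦ slotsOfRecordShift`,
`rawBOfRecord ι D … ↦ rawBOfRecordShift D ι …`, the reading binders in L-E9b's shape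
(the cov readings WINDOWED to
`{k | k ≤ D.K}` — `B13ReadingsLevelWindow.ReadsTowerCovAOn ∕ ReadsTowerCovBOn`, owner R55 ∕ typer T-S19 — jointly inhabited at the shifted slots by a
one-datum tower, W-21 §3; the off-window cov agreement is discharged INSIDE L-E9b by W-21 `cov_aligned_junk`, owner R56).  Imports this lineage's
`B13AssemblyCoresEndSubstrateShiftMeasOp`, leaf-10-g8's `B13StepEndInsOpBalaban` (for `sqrt_rate_pos_lt_one` ∕ `c1_balaban_nonneg` and, through
`B13StepEndArithmetic` ∕ `OutputRateArithmetic`, the reach-letter algebra `reach_elim_iff` ∕ `reach_binders_exists` ∕ `smallness_of_gain` BY NAME) and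
substrate-p1's `SubstrateO1ReadingsShift` ONLY; edits nothing; defines NO species reading (owner RULING R41) and constructs ∕ discharges NOTHING of the
instance (DESIGN RULE R34).  Summits-side new work under the LEAN PLACEMENT RULE (bookkeeping; 0 `def`, 0 cite tags — printed
KIND only).  HONEST FRAMING: rung (B)+1 of the FINITE-VOLUME T⁴ continuum programme — NOT infinite volume, NOT a mass gap, NOT the Clay problem, and
**NOT A PROOF OF NE5** (NOT PRINTED: the series prints ε-UNIFORM bounds, never η-RATES; cell GAPS G-t4-U3-1), NOT a proof of NE2 or NE3: the theorem is
an IMPLICATION whose wall binders are DISPLAYED HYPOTHESES about the substrate's letters and (2.14)-cores of record, asserted nowhere.  R48 ∕ R49 HONEST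
LINE: the slots of record are the VALUE-TABLE model (poorer than print at MI-R, [Balaban1988RG2Cluster] Lemma 1 (1.33)); Road D is of record for MI-R,
instance = substrate; VALUE UNCHANGED.  O-8-vol (R54 (3)): block torus at every depth = the final unit torus; printed bounds consumed are volume-uniform.
HONEST DEPENDENCY (cell line, verbatim): continuum YM on T⁴ ⇐ BetaPertH ∧ nine spine estimates (0/9 proved); BetaPertH ⇐ (D1) ∧ (D4) ∧ CAP+tail;
G-an2-4 gates asym, D1 and NE2/3/4.

WHAT THIS FILE DOES (composition BY NAME; no analytic estimate of its own).  **`uniform_ne5_of_substrateShift_cores_balaban_ne3Shape`**: fix the SIZES —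
node U1b's ∕ the owner's letters `o, d, L, M, a, α, β, Cn, a′, η, θ, B₁, B₂, B₃, Λ₂, …, Λ₅` (with `θ < 1` — here a SIZE, since `C₅` is chosen before the
data), the decay rate `κ ≥ 0`, the anchored exponential norm `0 ≤ Φ′ < 1∕36`, the levels `EA₀, E₀ ≥ 0`, the slice-budget constants `cA, cB ≥ 0`, the floor
`r₀ > 0`, W4's constant `δ′ ≥ 0`, the prescribed rate `√(max θ L⁻¹) ≤ θ′ ≤ 1`, the age damping `0 < ω < 1` — subject to the TWO STRICT SIZE
INEQUALITIES `cA(EA₀ + E₀) < 1 − ω`, `ω + (Φ′∕(1 − 36Φ′))·cA·(1 − ω)∕(1 − ω − cA(EA₀ + E₀)) < θ′`.  The reach letters `ρ₀ < 1`, `k₀`, `B ≥ 0` are then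
CHOSEN FROM THE SIZES (leaf-10's `reach_elim_iff` ∕ `reach_binders_exists` at the input rate `Θ := √(max θ L⁻¹)`, `0 < Θ < 1` by `sqrt_rate_pos_lt_one`,
W1's constant `c₁ := √(2B₁·2CpertRec∕(1 − Θ²)) + √(2B₂Λ₂CpertRec) + √(2B₃Λ₃CpertRec) + Λ₄Cn + Λ₅Cn ≥ 0` by `c1_balaban_nonneg`) and `C₅` is the diamond's
closed form `((Φ′∕(1 − 36Φ′)∕(1 − ρ₀))·(c₁∕r₀) + (Φ′∕(1 − 36Φ′)∕(1 − ρ₀))·δ′ + B)·(θ′ − ω)∕(θ′ − (ω + (Φ′∕(1 − 36Φ′)∕(1 − ρ₀))·cA))`.  Then for EVERY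
gauge group, driven two-run object `D : DrivenRuns 𝔾`, representation `ιr`, letters `cc ag sg`, frame `Pm`, insertion-operator sort `IOp`, factor
index data `𝒵 domZ Jc Vv mI`, EVERY letter package `Lsl` with `Lsl.ins.ω = ω`, its six letter conditions (p221190 §1, at the shifted slots) and
factorisation datum `(iopAt, hiopA)` (p221190 §2), admissible data `dom ∕ 𝒞 ∕ N ∕ RgV` in the (3.35)-class and in U1b's shape `NE3Shape … Cn θ`, towers
over `D`'s run-B backgrounds, O1 letters at the substrate's SHIFTED tables, window, W3 ×2, L05∕L06, `RawBounded` ×2, floor, W4 at `Θ`, rooms, factor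
letters `m⋆, mf, bf, N₀f` of the substrate's cores `coresRec` on the `measOp`-balls, history radius `H`, stripped majorant `A′` with its decay split and
its anchored-norm bound by `Φ′`: the displayed binders IMPLY `NE5 (B13StepOfRecord.outA (slotsOfRecordShift …) E₀ cB) (B13StepOfRecord.outB
(slotsOfRecordShift …) E₀ cB) W κ θ′ C₅` — ONE application of `…ShiftMeasOp` §1 per instance with `hwer` := substrate-p1's
`weightedEntrywiseRate_slotsOfRecordShift_balaban_ne3Shape`.  The η-UNIFORMITY is the quantifier order `∃ C₅, ∀ 𝔾 D … Lsl …`.  CENSUS vs p229762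
(binders, by name): MINUS = ∅; PLUS = ∅ (the two cov readings change SHAPE to the windowed
`ReadsTowerCov{A,B}On {k | k ≤ D.K}`, same binder names).  Headline wording (trigger c5 ∕ referee INFO-38): «END ⇐ instance letters», never «leaf
instantiated»; 0∕12 leaves on Bałaban's concrete objects; spine 0∕9.  `FlowStep.BetaPertH`, (B), (B^μ) do not occur.  0 sorry; axioms ⊆ {propext,
Classical.choice, Quot.sound}.
-/

noncomputable section

open scoped BigOperators Matrix.Norms.L2Operator
open Metric Set

namespace Summit.QuantumFields.BalabanUV.T4Continuum.B13AssemblyCoresEndSubstrateShiftBalabanUniform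

open _root_.MeasureTheory
open Literature.MathematicalPhysics.QuantumFieldTheory.Balaban1983to89
open Literature.MathematicalPhysics.QuantumFieldTheory.Balaban1983to89.T4OutputRate (DecayBound NE5)
open Literature.MathematicalPhysics.QuantumFieldTheory.Balaban1983to89.B5Prop11Plancherel (Tor fine)
open Literature.MathematicalPhysics.QuantumFieldTheory.Balaban1983to89.B5G183RateUnitTower (lev lev_neZero)
open Literature.MathematicalPhysics.QuantumFieldTheory.Balaban1983to89.T4EtaRateMin (NE3Shape)
open Summit.QuantumFields.BalabanUV.T4Continuum
open Summit.QuantumFields.BalabanUV.T4Continuum.B13OpDatum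
open Summit.QuantumFields.BalabanUV.T4Continuum.B13OpDatumJunctions (opOf RawBounded WeightedEntrywiseRate)
open Summit.QuantumFields.BalabanUV.T4Continuum.B13OpMeasurable (measOp)
open Summit.QuantumFields.BalabanUV.T4Continuum.B13StepTermLabels (InnerLabel)
open Summit.QuantumFields.BalabanUV.T4Continuum.B13InnerData (Bnd b13InnerData)
open Summit.QuantumFields.BalabanUV.T4Continuum.B13HistMeasurable (MeasPotFrame B13HistM)
open Summit.QuantumFields.BalabanUV.T4Continuum.B13TermCoreFamily (factorCores)
open Summit.QuantumFields.BalabanUV.T4Continuum.B13TermCoreMass (factorMass)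
open Summit.QuantumFields.BalabanUV.T4Continuum.UrsellTreeSum (ind)
open Summit.QuantumFields.BalabanUV.T4Continuum.UrsellTermBudget (actSum)
open Summit.QuantumFields.BalabanUV.T4Continuum.B13DomainGeometryTR (SCube footprint)
open Summit.QuantumFields.BalabanUV.T4Continuum.B13StepOfRecord (assembly step outA outB)
open Summit.QuantumFields.BalabanUV.T4Continuum.B13AssemblyCoresEndRestrictRecord (coresRec)
open Summit.QuantumFields.BalabanUV.T4Continuum.B13AssemblyCoresEndSubstrateShiftMeasOp (ne5_substrateShift_cores_actNorm)
open Summit.QuantumFields.BalabanUV.T4Continuum.B13StepOfRecordSubstrateShiftLetters (opB_mem_measOp_slotsOfRecordShift)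
open Summit.QuantumFields.BalabanUV.T4Continuum.B13StepEndArithmetic (reach_elim_iff smallness_of_gain)
open Summit.QuantumFields.BalabanUV.T4Continuum.OutputRateArithmetic (reach_binders_exists)
open Summit.QuantumFields.BalabanUV.T4Continuum.B13StepEndInsOpBalaban (sqrt_rate_pos_lt_one c1_balaban_nonneg)
open Summit.QuantumFields.BalabanUV.T4Continuum.B13ReadingsDecay (CovWeightDominatesDist)
open Summit.QuantumFields.BalabanUV.T4Continuum.B13ReadingsLevelWindow (ReadsTowerCovAOn ReadsTowerCovBOn)
open Summit.QuantumFields.BalabanUV.T4Continuum.B13ReadingsImage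
open Summit.QuantumFields.BalabanUV.T4Continuum.B13ReadingsLocal (PotQLipschitzReading PotRLipschitzReading)
open Summit.QuantumFields.BalabanUV.T4Continuum.B13ReadingsAssembly (CpertRec)
open Summit.QuantumFields.BalabanUV.T4Continuum.SubstrateO1ReadingsShift (weightedEntrywiseRate_slotsOfRecordShift_balaban_ne3Shape)
open Summit.QuantumFields.BalabanUV.T4Continuum.DecayRateInterpolation (EntryDecay)
open Summit.QuantumFields.BalabanUV.T4Continuum.SubstrateBackgroundTransporters (unitMod)
open Summit.QuantumFields.BalabanUV.T4Continuum.SubstrateTwoRunsDriven (DrivenRuns)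
open Summit.QuantumFields.BalabanUV.T4Continuum.SubstrateRawSpecies
open Summit.QuantumFields.BalabanUV.T4Continuum.SubstrateSlotsOfRecord
open Summit.QuantumFields.BalabanUV.T4Continuum.SubstrateSlotsOfRecordShift
open Summit.QuantumFields.BalabanUV.T4Continuum.BalabanAveragedTowerUnit (idx)
open Summit.QuantumFields.BalabanUV.T4Continuum.GaugeTermScalarData (QuT Q1)
open Summit.QuantumFields.BalabanUV.T4Continuum.RegularSiteTransporters (siteT)
open Summit.QuantumFields.BalabanUV.T4Continuum.RegularBackgroundTower (RegularTransporters)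
open Summit.QuantumFields.BalabanUV.T4Continuum.NE2ColourPerturbedLayer (pertCovC)
open Summit.QuantumFields.BalabanUV.T4Continuum.NE2BalabanRoot (balabanPert)
open Summit.QuantumFields.BalabanUV.T4Continuum.NE2BalabanGauge (gaugeSlot liftR)
open Summit.QuantumFields.BalabanUV.T4Continuum.NE2BalabanThreshold (etaStar)
open Summit.QuantumFields.BalabanUV.T4Continuum.NE2FromNE3Carrier (ne2Loc)
open Summit.QuantumFields.BalabanUV.T4Continuum.MinimalActionRate (minActReadings)

section Uniform

variable {d : ℕ} (L : ℕ) [NeZero L] (M : Fin d → ℕ) [hM : ∀ μ, NeZero (M μ)] (a : ℝ) (ha : 0 < a)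
variable {o : Type*} [Fintype o] [DecidableEq o] {α β C a' η θ : ℝ} {m : Type*} [Fintype m] [DecidableEq m]

/-- [folklore] **ONE CONSTANT FOR EVERY DRIVEN TWO-RUN OBJECT AND EVERY LETTER PACKAGE (η-UNIFORMITY AT THE SUBSTRATE's LEVEL-SHIFTED O1 INSTANCE)
ON THE (2.14)-CORES ROAD, W1 PRODUCED AT BAŁABAN's TIER-B BACKGROUND, REACH LETTERS CHOSEN FROM THE SIZES** — this lineage's explicit-constant face
`B13AssemblyCoresEndSubstrateShiftMeasOp.ne5_substrateShift_cores_actNorm` (N191 §1 at the shifted slots) applied ONCE per instance, its `hwer` binder supplied by substrate-p1's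
`weightedEntrywiseRate_slotsOfRecordShift_balaban_ne3Shape`, `hc₁ ∕ hθ` by `c1_balaban_nonneg` ∕ `sqrt_rate_pos_lt_one`, `hE₁ := one_pos`, and the reach letters
`ρ₀, k₀, B` (binders `hρ₀ ∕ hnear ∕ hB ∕ hfirst ∕ hsmall`) obtained BEFORE the data from the two strict size inequalities by `reach_elim_iff` ∕
`reach_binders_exists` ∕ `smallness_of_gain` at the gain `Φ′∕(1 − 36Φ′)`.  See the module docstring for the list of what is fixed outside `∃ C₅` (SIZES)
and what is quantified inside (EVERYTHING ELSE).  NOT a proof of NE5 ∕ NE2 ∕ NE3: an implication from displayed binders, the quantifier order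
`∃ C₅, ∀ 𝔾 D … Lsl …` being the point. -/
theorem uniform_ne5_of_substrateShift_cores_balaban_ne3Shape (hL : 2 ≤ L) (hd : 1 ≤ d) (hα : 0 ≤ α) (hβ : 0 ≤ β) (hC : 0 ≤ C) (ha' : 0 < a')
    (hαη : α ≤ η) (hβη : β ≤ η) (hη : η ≤ etaStar o d a a') {B₁ B₂ B₃ Λ₂ Λ₃ Λ₄ Λ₅ : ℝ} (hΛ₂ : 0 ≤ Λ₂) (hΛ₃ : 0 ≤ Λ₃)
    (hΛ₄ : 0 ≤ Λ₄) (hΛ₅ : 0 ≤ Λ₅) (hθ1 : θ < 1) {κ Φ' EA₀ E₀ cA cB r₀ δ' θ' ω : ℝ}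
    (hκ : 0 ≤ κ) (hΦ0 : 0 ≤ Φ') (hsmallΦ : 36 * Φ' < 1)
    (hE₀ : 0 ≤ E₀) (hcA : 0 ≤ cA) (hcB : 0 ≤ cB) (hr₀ : 0 < r₀) (hδ' : 0 ≤ δ')
    (hθθ' : Real.sqrt (max θ ((L : ℝ)⁻¹)) ≤ θ') (hθ'1 : θ' ≤ 1) (hω : 0 < ω) (hω1 : ω < 1)
    (hh : cA * (EA₀ + E₀) < 1 - ω) (hsmall : ω + Φ' / (1 - 36 * Φ') * cA * (1 - ω) / (1 - ω - cA * (EA₀ + E₀)) < θ') :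
    ∃ C₅ : ℝ, ∀ {𝔾 : Type} [GaugeGroup 𝔾] (D : DrivenRuns 𝔾) {oc : Type} [Fintype oc] [DecidableEq oc] (ιr : 𝔾 →* Matrix oc oc ℂ) (cc : ℂ)
      (ag : ℝ) (sg : ℕ → ℂ) {T ι' Sy Ω 𝒴 : Type} [MeasurableSpace Ω] (Pm : MeasPotFrame D.carriers) {IOp : Type*}
      (𝒵 : D.carriers.Dom → InnerLabel D.carriers.Dom (Bnd D.toTwoRuns) → Type) [∀ Z j, Fintype (𝒵 Z j)]
      (domZ : ∀ Z j, 𝒵 Z j → D.carriers.Dom) (Jc : D.carriers.Dom → InnerLabel D.carriers.Dom (Bnd D.toTwoRuns) → Type)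
      [∀ Z j, Fintype (Jc Z j)] (Vv : D.carriers.Dom → InnerLabel D.carriers.Dom (Bnd D.toTwoRuns) → Type)
      [∀ Z j, NormedAddCommGroup (Vv Z j)] [∀ Z j, InnerProductSpace ℝ (Vv Z j)] [∀ Z j, MeasurableSpace (Vv Z j)] [∀ Z j, BorelSpace (Vv Z j)]
      [∀ Z j, FiniteDimensional ℝ (Vv Z j)] (mI : D.carriers.Dom → InnerLabel D.carriers.Dom (Bnd D.toTwoRuns) → Type)
      [∀ Z j, Fintype (mI Z j)] [∀ Z j, DecidableEq (mI Z j)]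
      (Lsl : SlotLetters D (o := oc) (T := T) (ι' := ι') (S := Sy) (Ω := Ω) (𝒴 := 𝒴) Pm (IOp := IOp) 𝒵 domZ Jc Vv mI)
      -- p221190 §1's letter conditions on run B's tables (named: they type the `measOp`-ball centres below) and the factorisation datum's map
      (hbdB : ∀ (g : ℕ → ℝ) (U : D.carriers.BgB) (k : ℕ),
        FormatBounded (Lsl.W k).format (rawBOfRecordShift D ιr cc ag sg Lsl.ΓB Lsl.dkB Lsl.gcB Lsl.pQB Lsl.pRB g U k).kernel)
      (hmQB : ∀ (r : ℝ) (U : GaugeField (D.F.P (D.K + 1)) 0 𝔾) (k : ℕ) (Y : 𝒴) (b b' : ((Tor (unitMod (D.F.P D.K)) × Fin (D.F.P D.K).d) × oc)),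
        Measurable fun x : Ω => Lsl.pQB r U k x Y b b')
      (hmRB : ∀ (r : ℝ) (U : GaugeField (D.F.P (D.K + 1)) 0 𝔾) (k : ℕ) (Y : 𝒴), Measurable fun x : Ω => Lsl.pRB r U k x Y)
      (iopAt : ℝ → D.carriers.BgA → ℕ → IOp)
      {𝒞 : ℕ → Set (B7Prop1Explicit.Site d → Fin d → (Matrix o o ℂ)ˣ)} {N : ℕ}
      {dom : Set (B7Prop1Explicit.Site d → Fin d → (Matrix o o ℂ)ˣ)}
      {RgV : (B7Prop1Explicit.Site d → Fin d → (Matrix o o ℂ)ˣ) → ((k : ℕ) → Fin d → (Tor (fine (lev L k) M) → Matrix o o ℂ))}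
      {tow : ℕ → (ℕ → ℝ) → D.toTwoRuns.carriers.BgB → ↥dom} {W : Set (ℕ → ℝ)}
      {σ : T → ((Tor (unitMod (D.F.P D.K)) × Fin (D.F.P D.K).d) × oc) → idx L M 0 × o} {dist₁ : idx L M 0 × o → idx L M 0 × o → ℝ} {δ₁ : ℝ}
      {S₂ : Set (Matrix (idx L M 0 × o) (idx L M 0 × o) ℂ)} {Φ : T → Matrix (idx L M 0 × o) (idx L M 0 × o) ℂ → Matrix m m ℂ}
      {dist₂ : m → m → ℝ} {δ₂ : ℝ} {σX : T → ι' → m}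
      {S₃ : Set (Matrix (idx L M 0 × o) (idx L M 0 × o) ℂ)} {Ψ : T → Matrix (idx L M 0 × o) (idx L M 0 × o) ℂ → Matrix m m ℂ}
      {dist₃ : m → m → ℝ} {δ₃ : ℝ} {σB : T → ((Tor (unitMod (D.F.P D.K)) × Fin (D.F.P D.K).d) × oc) → m}
      {ROp RHist R' H : ℕ → ℝ} {N₀f mf bf : D.carriers.Dom → InnerLabel D.carriers.Dom (Bnd D.toTwoRuns) → ℝ}
      {A' : ℕ → D.carriers.Dom → InnerLabel D.carriers.Dom (Bnd D.toTwoRuns) → ℝ} {mstar : ℝ},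
      Lsl.ins.ω = ω →
      -- p221190 §1's letter conditions on run A's tables and the factorisation identity (L01)
      (∀ (g : ℕ → ℝ) (U : D.carriers.BgA) (k : ℕ),
        FormatBounded (Lsl.W k).format (rawAOfRecord ιr D cc ag sg Lsl.ΓA Lsl.dkA Lsl.gcA Lsl.pQA Lsl.pRA g U k).kernel) →
      (∀ (r : ℝ) (U : GaugeField (D.F.P D.K) 0 𝔾) (k : ℕ) (Y : 𝒴) (b b' : ((Tor (unitMod (D.F.P D.K)) × Fin (D.F.P D.K).d) × oc)),
        Measurable fun x : Ω => Lsl.pQA r U k x Y b b') →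
      (∀ (r : ℝ) (U : GaugeField (D.F.P D.K) 0 𝔾) (k : ℕ) (Y : 𝒴), Measurable fun x : Ω => Lsl.pRA r U k x Y) →
      (∀ (r : ℝ) (U : D.carriers.BgB) (k : ℕ), Lsl.ins.iopA r U k = iopAt r (D.carriers.transport U) k) →
      -- node U1b's shape on the (3.35)-class and the owner's O1 letters at the substrate's tables
      (∀ V ∈ dom, RegularTransporters L M (liftR L M (RgV V)) α β) →
      NE3Shape (minActReadings d 𝒞 L N dom (ne2Loc L M fun V => liftR L M (RgV V))) C θ →
      (∀ V ∈ dom, ∀ k, EntryDecay dist₁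
        (pertCovC L M a ha (balabanPert L M a (liftR L M (RgV V)) (gaugeSlot L M (RgV V) (QuT L M o (siteT L M (RgV V))) (Q1 L M o) a'))
          1 k) B₁ δ₁) →
      ReadsTowerCovAOn {k : ℕ | k ≤ D.K}
        (fun V : ↥dom => pertCovC L M a ha
          (balabanPert L M a (liftR L M (RgV V)) (gaugeSlot L M (RgV V) (QuT L M o (siteT L M (RgV V))) (Q1 L M o) a')) 1)
        σ tow (fun g U k => (rawAOfRecord ιr D cc ag sg Lsl.ΓA Lsl.dkA Lsl.gcA Lsl.pQA Lsl.pRA) g (D.toTwoRuns.carriers.transport U) k) W →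
      ReadsTowerCovBOn {k : ℕ | k ≤ D.K}
        (fun V : ↥dom => pertCovC L M a ha
          (balabanPert L M a (liftR L M (RgV V)) (gaugeSlot L M (RgV V) (QuT L M o (siteT L M (RgV V))) (Q1 L M o) a')) 1)
        σ tow (rawBOfRecordShift D ιr cc ag sg Lsl.ΓB Lsl.dkB Lsl.gcB Lsl.pQB Lsl.pRB) W →
      CovWeightDominatesDist (slotsOfRecordShift D ιr cc ag sg Pm 𝒵 domZ Jc Vv mI Lsl).F dist₁ σ (δ₁ / 2) →
      (∀ t, OpLipschitzOn S₂ (Φ t) Λ₂) →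
      (∀ V ∈ dom, ∀ k, pertCovC L M a ha
        (balabanPert L M a (liftR L M (RgV V)) (gaugeSlot L M (RgV V) (QuT L M o (siteT L M (RgV V))) (Q1 L M o) a')) 1 k ∈ S₂) →
      (∀ V ∈ dom, ∀ t k, EntryDecay dist₂ (Φ t (pertCovC L M a ha
        (balabanPert L M a (liftR L M (RgV V)) (gaugeSlot L M (RgV V) (QuT L M o (siteT L M (RgV V))) (Q1 L M o) a')) 1 k)) B₂ δ₂) →
      ReadsTowerDeltaA (fun (V : ↥dom) t k => Φ t (pertCovC L M a ha
        (balabanPert L M a (liftR L M (RgV V)) (gaugeSlot L M (RgV V) (QuT L M o (siteT L M (RgV V))) (Q1 L M o) a')) 1 k))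
        σX tow (fun g U k => (rawAOfRecord ιr D cc ag sg Lsl.ΓA Lsl.dkA Lsl.gcA Lsl.pQA Lsl.pRA) g (D.toTwoRuns.carriers.transport U) k) W →
      ReadsTowerDeltaB (fun (V : ↥dom) t k => Φ t (pertCovC L M a ha
        (balabanPert L M a (liftR L M (RgV V)) (gaugeSlot L M (RgV V) (QuT L M o (siteT L M (RgV V))) (Q1 L M o) a')) 1 k))
        σX tow (rawBOfRecordShift D ιr cc ag sg Lsl.ΓB Lsl.dkB Lsl.gcB Lsl.pQB Lsl.pRB) W →
      DeltaWeightDominatesDist (slotsOfRecordShift D ιr cc ag sg Pm 𝒵 domZ Jc Vv mI Lsl).F dist₂ σX (δ₂ / 2) →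
      (∀ t, OpLipschitzOn S₃ (Ψ t) Λ₃) →
      (∀ V ∈ dom, ∀ k, pertCovC L M a ha
        (balabanPert L M a (liftR L M (RgV V)) (gaugeSlot L M (RgV V) (QuT L M o (siteT L M (RgV V))) (Q1 L M o) a')) 1 k ∈ S₃) →
      (∀ V ∈ dom, ∀ t k, EntryDecay dist₃ (Ψ t (pertCovC L M a ha
        (balabanPert L M a (liftR L M (RgV V)) (gaugeSlot L M (RgV V) (QuT L M o (siteT L M (RgV V))) (Q1 L M o) a')) 1 k)) B₃ δ₃) →
      ReadsTowerGammaA (fun (V : ↥dom) t k => Ψ t (pertCovC L M a ha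
        (balabanPert L M a (liftR L M (RgV V)) (gaugeSlot L M (RgV V) (QuT L M o (siteT L M (RgV V))) (Q1 L M o) a')) 1 k))
        σB σX tow (fun g U k => (rawAOfRecord ιr D cc ag sg Lsl.ΓA Lsl.dkA Lsl.gcA Lsl.pQA Lsl.pRA) g (D.toTwoRuns.carriers.transport U) k) W →
      ReadsTowerGammaB (fun (V : ↥dom) t k => Ψ t (pertCovC L M a ha
        (balabanPert L M a (liftR L M (RgV V)) (gaugeSlot L M (RgV V) (QuT L M o (siteT L M (RgV V))) (Q1 L M o) a')) 1 k))
        σB σX tow (rawBOfRecordShift D ιr cc ag sg Lsl.ΓB Lsl.dkB Lsl.gcB Lsl.pQB Lsl.pRB) W →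
      GammaWeightDominatesDist (slotsOfRecordShift D ιr cc ag sg Pm 𝒵 domZ Jc Vv mI Lsl).F dist₃ σB σX (δ₃ / 2) →
      PotQLipschitzReading (minActReadings d 𝒞 L N dom (ne2Loc L M fun V => liftR L M (RgV V))) (slotsOfRecordShift D ιr cc ag sg Pm 𝒵 domZ Jc Vv mI Lsl).F
        (fun g U k => (rawAOfRecord ιr D cc ag sg Lsl.ΓA Lsl.dkA Lsl.gcA Lsl.pQA Lsl.pRA) g (D.toTwoRuns.carriers.transport U) k)
        (rawBOfRecordShift D ιr cc ag sg Lsl.ΓB Lsl.dkB Lsl.gcB Lsl.pQB Lsl.pRB) W Λ₄ →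
      PotRLipschitzReading (minActReadings d 𝒞 L N dom (ne2Loc L M fun V => liftR L M (RgV V))) (slotsOfRecordShift D ιr cc ag sg Pm 𝒵 domZ Jc Vv mI Lsl).F
        (fun g U k => (rawAOfRecord ιr D cc ag sg Lsl.ΓA Lsl.dkA Lsl.gcA Lsl.pQA Lsl.pRA) g (D.toTwoRuns.carriers.transport U) k)
        (rawBOfRecordShift D ιr cc ag sg Lsl.ΓB Lsl.dkB Lsl.gcB Lsl.pQB Lsl.pRB) W Λ₅ →
      -- the rest of `…ShiftMeasOp` §1 (p222947 §1 at the shifted slots) at the instance: W3 ×2, L05∕L06, `RawBounded` ×2, floor, W4 at the input rate, rooms, history radius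
      (assembly (slotsOfRecordShift D ιr cc ag sg Pm 𝒵 domZ Jc Vv mI Lsl)).SliceBudgetB W κ cB →
      (slotsOfRecordShift D ιr cc ag sg Pm 𝒵 domZ Jc Vv mI Lsl).D.SliceBudget (step (slotsOfRecordShift D ιr cc ag sg Pm 𝒵 domZ Jc Vv mI Lsl) E₀ cB) W κ cA →
      DecayBound (outA (slotsOfRecordShift D ιr cc ag sg Pm 𝒵 domZ Jc Vv mI Lsl) E₀ cB) W EA₀ κ →
      DecayBound (outB (slotsOfRecordShift D ιr cc ag sg Pm 𝒵 domZ Jc Vv mI Lsl) E₀ cB) W E₀ κ →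
      RawBounded (slotsOfRecordShift D ιr cc ag sg Pm 𝒵 domZ Jc Vv mI Lsl).F (assembly (slotsOfRecordShift D ιr cc ag sg Pm 𝒵 domZ Jc Vv mI Lsl)).rawAt W →
      RawBounded (slotsOfRecordShift D ιr cc ag sg Pm 𝒵 domZ Jc Vv mI Lsl).F (slotsOfRecordShift D ιr cc ag sg Pm 𝒵 domZ Jc Vv mI Lsl).rawB W →
      (∀ k, r₀ ≤ Lsl.rOp k) →
      (step (slotsOfRecordShift D ιr cc ag sg Pm 𝒵 domZ Jc Vv mI Lsl) E₀ cB).InsertionRate W κ E₀ δ' (Real.sqrt (max θ ((L : ℝ)⁻¹))) →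
      (∀ k, Lsl.rOp k ≤ ROp k) → (∀ k, ROp k < R' k) →
      (∀ k, (assembly (slotsOfRecordShift D ιr cc ag sg Pm 𝒵 domZ Jc Vv mI Lsl)).bHist E₀ cB k + Lsl.rHist k ≤ RHist k) →
      -- the FACTOR operator letters of the substrate's cores of record on the `measOp`-balls about run B's datum of record
      0 < mstar → (∀ Z ℓ, mstar ≤ mf Z ℓ) → (∀ Z ℓ, 0 ≤ N₀f Z ℓ) →
      (∀ k, ∀ g ∈ W, ∀ (U : D.carriers.BgB) (X : D.carriers.Dom), D.carriers.scale X = k →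
        ∀ i, (assembly (slotsOfRecordShift D ιr cc ag sg Pm 𝒵 domZ Jc Vv mI Lsl)).𝒯.Rel k i X →
        ∀ n : Fin ((assembly (slotsOfRecordShift D ιr cc ag sg Pm 𝒵 domZ Jc Vv mI Lsl)).𝒯.len i + 1),
        (∀ op ∈ ball (⟨opOf (slotsOfRecordShift D ιr cc ag sg Pm 𝒵 domZ Jc Vv mI Lsl).F (slotsOfRecordShift D ιr cc ag sg Pm 𝒵 domZ Jc Vv mI Lsl).rawB g U k,
            opB_mem_measOp_slotsOfRecordShift D ιr cc ag sg Pm 𝒵 domZ Jc Vv mI Lsl hbdB hmQB hmRB g U k⟩ :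
              measOp T ((Tor (unitMod (D.F.P D.K)) × Fin (D.F.P D.K).d) × oc) ι' Ω 𝒴) (R' k),
          AEStronglyMeasurable ((factorCores (assembly (slotsOfRecordShift D ιr cc ag sg Pm 𝒵 domZ Jc Vv mI Lsl)).𝒯 (coresRec D Pm 𝒵 domZ Jc Vv mI Lsl) i n).N
            (op : OpDatum _)) (factorCores (assembly (slotsOfRecordShift D ιr cc ag sg Pm 𝒵 domZ Jc Vv mI Lsl)).𝒯 (coresRec D Pm 𝒵 domZ Jc Vv mI Lsl) i n).lam) ∧
        (∀ p, DifferentiableOn ℂ (fun op : measOp T ((Tor (unitMod (D.F.P D.K)) × Fin (D.F.P D.K).d) × oc) ι' Ω 𝒴 =>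
            (factorCores (assembly (slotsOfRecordShift D ιr cc ag sg Pm 𝒵 domZ Jc Vv mI Lsl)).𝒯 (coresRec D Pm 𝒵 domZ Jc Vv mI Lsl) i n).N (op : OpDatum _) p)
          (ball (⟨opOf (slotsOfRecordShift D ιr cc ag sg Pm 𝒵 domZ Jc Vv mI Lsl).F (slotsOfRecordShift D ιr cc ag sg Pm 𝒵 domZ Jc Vv mI Lsl).rawB g U k,
            opB_mem_measOp_slotsOfRecordShift D ιr cc ag sg Pm 𝒵 domZ Jc Vv mI Lsl hbdB hmQB hmRB g U k⟩ :
              measOp T ((Tor (unitMod (D.F.P D.K)) × Fin (D.F.P D.K).d) × oc) ι' Ω 𝒴) (R' k))) ∧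
        (∀ op ∈ ball (⟨opOf (slotsOfRecordShift D ιr cc ag sg Pm 𝒵 domZ Jc Vv mI Lsl).F (slotsOfRecordShift D ιr cc ag sg Pm 𝒵 domZ Jc Vv mI Lsl).rawB g U k,
            opB_mem_measOp_slotsOfRecordShift D ιr cc ag sg Pm 𝒵 domZ Jc Vv mI Lsl hbdB hmQB hmRB g U k⟩ :
              measOp T ((Tor (unitMod (D.F.P D.K)) × Fin (D.F.P D.K).d) × oc) ι' Ω 𝒴) (R' k), ∀ p,
          ‖(factorCores (assembly (slotsOfRecordShift D ιr cc ag sg Pm 𝒵 domZ Jc Vv mI Lsl)).𝒯 (coresRec D Pm 𝒵 domZ Jc Vv mI Lsl) i n).N (op : OpDatum _) p‖ ≤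
            N₀f ((assembly (slotsOfRecordShift D ιr cc ag sg Pm 𝒵 domZ Jc Vv mI Lsl)).𝒯.poly i n)
              ((assembly (slotsOfRecordShift D ιr cc ag sg Pm 𝒵 domZ Jc Vv mI Lsl)).𝒯.lab i n))) →
      (∀ k, ∀ g ∈ W, ∀ (U : D.carriers.BgB) (X : D.carriers.Dom), D.carriers.scale X = k →
        ∀ i, (assembly (slotsOfRecordShift D ιr cc ag sg Pm 𝒵 domZ Jc Vv mI Lsl)).𝒯.Rel k i X →
        ∀ n : Fin ((assembly (slotsOfRecordShift D ιr cc ag sg Pm 𝒵 domZ Jc Vv mI Lsl)).𝒯.len i + 1),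
        (∀ op ∈ ball (⟨opOf (slotsOfRecordShift D ιr cc ag sg Pm 𝒵 domZ Jc Vv mI Lsl).F (slotsOfRecordShift D ιr cc ag sg Pm 𝒵 domZ Jc Vv mI Lsl).rawB g U k,
            opB_mem_measOp_slotsOfRecordShift D ιr cc ag sg Pm 𝒵 domZ Jc Vv mI Lsl hbdB hmQB hmRB g U k⟩ :
              measOp T ((Tor (unitMod (D.F.P D.K)) × Fin (D.F.P D.K).d) × oc) ι' Ω 𝒴) (R' k),
          AEStronglyMeasurable (Function.uncurry
            ((factorCores (assembly (slotsOfRecordShift D ιr cc ag sg Pm 𝒵 domZ Jc Vv mI Lsl)).𝒯 (coresRec D Pm 𝒵 domZ Jc Vv mI Lsl) i n).q (op : OpDatum _)))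
            ((factorCores (assembly (slotsOfRecordShift D ιr cc ag sg Pm 𝒵 domZ Jc Vv mI Lsl)).𝒯 (coresRec D Pm 𝒵 domZ Jc Vv mI Lsl) i n).lam.prod volume)) ∧
        (∀ p v, DifferentiableOn ℂ (fun op : measOp T ((Tor (unitMod (D.F.P D.K)) × Fin (D.F.P D.K).d) × oc) ι' Ω 𝒴 =>
            (factorCores (assembly (slotsOfRecordShift D ιr cc ag sg Pm 𝒵 domZ Jc Vv mI Lsl)).𝒯 (coresRec D Pm 𝒵 domZ Jc Vv mI Lsl) i n).q (op : OpDatum _) p v)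
          (ball (⟨opOf (slotsOfRecordShift D ιr cc ag sg Pm 𝒵 domZ Jc Vv mI Lsl).F (slotsOfRecordShift D ιr cc ag sg Pm 𝒵 domZ Jc Vv mI Lsl).rawB g U k,
            opB_mem_measOp_slotsOfRecordShift D ιr cc ag sg Pm 𝒵 domZ Jc Vv mI Lsl hbdB hmQB hmRB g U k⟩ :
              measOp T ((Tor (unitMod (D.F.P D.K)) × Fin (D.F.P D.K).d) × oc) ι' Ω 𝒴) (R' k))) ∧
        (∀ op ∈ ball (⟨opOf (slotsOfRecordShift D ιr cc ag sg Pm 𝒵 domZ Jc Vv mI Lsl).F (slotsOfRecordShift D ιr cc ag sg Pm 𝒵 domZ Jc Vv mI Lsl).rawB g U k,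
            opB_mem_measOp_slotsOfRecordShift D ιr cc ag sg Pm 𝒵 domZ Jc Vv mI Lsl hbdB hmQB hmRB g U k⟩ :
              measOp T ((Tor (unitMod (D.F.P D.K)) × Fin (D.F.P D.K).d) × oc) ι' Ω 𝒴) (R' k), ∀ p v,
          mf ((assembly (slotsOfRecordShift D ιr cc ag sg Pm 𝒵 domZ Jc Vv mI Lsl)).𝒯.poly i n)
              ((assembly (slotsOfRecordShift D ιr cc ag sg Pm 𝒵 domZ Jc Vv mI Lsl)).𝒯.lab i n) * ‖v‖ ^ 2 -
            bf ((assembly (slotsOfRecordShift D ιr cc ag sg Pm 𝒵 domZ Jc Vv mI Lsl)).𝒯.poly i n)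
              ((assembly (slotsOfRecordShift D ιr cc ag sg Pm 𝒵 domZ Jc Vv mI Lsl)).𝒯.lab i n) ≤
            ((factorCores (assembly (slotsOfRecordShift D ιr cc ag sg Pm 𝒵 domZ Jc Vv mI Lsl)).𝒯 (coresRec D Pm 𝒵 domZ Jc Vv mI Lsl) i n).q
              (op : OpDatum _) p v).re)) →
      (∀ k, ∀ g ∈ W, ∀ U : D.carriers.BgB, ‖(assembly (slotsOfRecordShift D ιr cc ag sg Pm 𝒵 domZ Jc Vv mI Lsl)).histRef g U k‖ + RHist k ≤ H k) →
      -- the stripped majorant with its decay split and its anchored exponential norm bounded by `Φ′`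
      (∀ k Z ℓ, 0 ≤ A' k Z ℓ) →
      (∀ k Z ℓ, factorMass (coresRec D Pm 𝒵 domZ Jc Vv mI Lsl) N₀f bf mstar (H k) Z ℓ ≤ A' k Z ℓ * Real.exp (-(κ * (D.carriers.d Z + 5)))) →
      (∀ (k : ℕ) (q : SCube D.toTwoRuns), ∑ Z ∈ D.toTwoRuns.domAt k,
        ind (q ∈ footprint Z) * actSum (b13InnerData D.toTwoRuns) (A' k) k Z * Real.exp ((footprint Z).card) ≤ Φ') →
      NE5 (outA (slotsOfRecordShift D ιr cc ag sg Pm 𝒵 domZ Jc Vv mI Lsl) E₀ cB)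
        (outB (slotsOfRecordShift D ιr cc ag sg Pm 𝒵 domZ Jc Vv mI Lsl) E₀ cB) W κ θ' C₅ := by
  obtain ⟨hΘ0, hΘ1⟩ := sqrt_rate_pos_lt_one L hL hθ1
  have hc₁ : 0 ≤ Real.sqrt (2 * B₁ * (2 * CpertRec o d L a α β C a' / (1 - max θ ((L : ℝ)⁻¹)))) +
      Real.sqrt (2 * B₂ * (Λ₂ * CpertRec o d L a α β C a')) + Real.sqrt (2 * B₃ * (Λ₃ * CpertRec o d L a α β C a')) +
      Λ₄ * C + Λ₅ * C := c1_balaban_nonneg L a hC hΛ₄ hΛ₅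
  have hG : 0 ≤ Φ' / (1 - 36 * Φ') := div_nonneg hΦ0 (by linarith)
  obtain ⟨ρ₀, hreach, hρ₀, hs⟩ := (reach_elim_iff (mul_nonneg hG hcA) hω1).mpr ⟨hh, hsmall⟩
  obtain ⟨k₀, B, hB, hnear, hfirst⟩ := reach_binders_exists
    (D := (Real.sqrt (2 * B₁ * (2 * CpertRec o d L a α β C a' / (1 - max θ ((L : ℝ)⁻¹)))) +
      Real.sqrt (2 * B₂ * (Λ₂ * CpertRec o d L a α β C a')) + Real.sqrt (2 * B₃ * (Λ₃ * CpertRec o d L a α β C a')) +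
      Λ₄ * C + Λ₅ * C) / r₀ + δ') (add_nonneg (div_nonneg hc₁ hr₀.le) hδ') hΘ0 hΘ1 hreach
  refine ⟨(Φ' / (1 - 36 * Φ') / (1 - ρ₀) *
      ((Real.sqrt (2 * B₁ * (2 * CpertRec o d L a α β C a' / (1 - max θ ((L : ℝ)⁻¹)))) +
        Real.sqrt (2 * B₂ * (Λ₂ * CpertRec o d L a α β C a')) + Real.sqrt (2 * B₃ * (Λ₃ * CpertRec o d L a α β C a')) +
        Λ₄ * C + Λ₅ * C) / r₀) + Φ' / (1 - 36 * Φ') / (1 - ρ₀) * δ' + B) * (θ' - ω) /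
      (θ' - (ω + Φ' / (1 - 36 * Φ') / (1 - ρ₀) * cA)), ?_⟩
  intro 𝔾 _ D oc _ _ ιr cc ag sg T ι' Sy Ω 𝒴 _ Pm IOp 𝒵 _ domZ Jc _ Vv _ _ _ _ _ mI _ _ Lsl hbdB hmQB hmRB iopAt 𝒞 N dom RgV tow W σ dist₁ δ₁ S₂
    Φ dist₂ δ₂ σX S₃ Ψ dist₃ δ₃ σB ROp RHist R' H N₀f mf bf A' mstar hLω hbdA hmQA hmRA hiopA hreg hNE3 hdec hcovA hcovB hdom₁ hΦ hS₂ hdecΦ hΔA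
    hΔB hdom₂ hΨ hS₃ hdecΨ hΓA hΓB hdom₃ hQ hR hbB hbA hdA hdB hRA hRB hfl hins hOp hroom hHist hm hmf hN₀ hNf hqf hH hA0' hdecM hΦ'
  subst hLω
  have hwer := weightedEntrywiseRate_slotsOfRecordShift_balaban_ne3Shape D ιr cc ag sg Pm 𝒵 domZ Jc Vv mI Lsl L M a ha hL hd hreg hα hβ hC hNE3 ha'
    hαη hβη hη hdec hcovA hcovB hdom₁ hΦ hΛ₂ hS₂ hdecΦ hΔA hΔB hdom₂ hΨ hΛ₃ hS₃ hdecΨ hΓA hΓB hdom₃ hΛ₄ hΛ₅ hQ hR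
  exact ne5_substrateShift_cores_actNorm D ιr cc ag sg Pm 𝒵 domZ Jc Vv mI Lsl hbdA hmQA hmRA hbdB hmQB hmRB iopAt hiopA E₀ cB hbB hbA hdA hdB hRA
    hRB hwer hfl hins hOp hroom hHist hm hmf hN₀ hNf hqf hH hκ hA0' hdecM hΦ0 hsmallΦ hΦ' hE₀ one_pos hcA hcB hc₁ hr₀ hδ' hΘ0.le hθθ' hθ'1
    hω hω1 hρ₀ hnear hB hfirst (smallness_of_gain hs)

end Uniform

end Summit.QuantumFields.BalabanUV.T4Continuum.B13AssemblyCoresEndSubstrateShiftBalabanUniform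

end
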